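import Summits.CriticalPhenomena.PercolationContinuityZ3.Theorems.PercNearOneGluingAdditiveGluingAL5RestrictedBHK
import HarnessLib

/-! # Crux `PercNearOneGluing.AdditiveGluing` (stmt-CriticalPhenomena-4576) — Kozma–Nitzan's Lemma 3(i) RESTRICTED to
# `{C_{a₁} ∩ X = ∅}`

Support file (`--supports stmt-CriticalPhenomena-4576`; task png-dp-al5); no definitions, no named facts.
`μ = prodBernoulli w` on the bond configurations of a finite weighted graph, `C_v` the open edge cluster.

**Theorem (`knLemma3i_restricted`).**  Let `M = {a₁ ↮ X}` (`a₁ ∉ X`, `a₁ ≠ a₂`), `Q` increasing and determined by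
`C_{a₂}`, `d ≥ 0`.  If `μ(M ∩ {a₁ ↔ b}) ≤ μ(M ∩ {a₂ ↔ b}) + d` then `μ(M ∩ {a₁ ↔ b} ∩ Q) ≤ μ(M ∩ {a₂ ↔ b} ∩ Q) + d`.
For `X = ∅` this is Kozma–Nitzan's Lemma 3(i) (`knLemma3i`); the point is that BOTH the hypothesis and the conclusion are
restricted to the event that the WEAK vertex `a₁` is not joined to `X` — the form in which comparisons survive the
deletion/gluing steps of the AL5 ladder (task notes: "restricted transfer"; the analogous statement with the restriction on
a third vertex's cluster is false, 5/361 exact counterexamples).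

**Proof.**  KN's proof of Lemma 3 (pp. 6–7) on `N = M ∩ {a₁ ↮ a₂} = {C_{a₁} ∩ (X ∪ {a₂}) = ∅}`, the two correlation
inequalities (`rbhk_neg`: `1{a₁↔b}` vs `1_Q`; `rbhk_pos`: `1{a₂↔b}` vs `1_Q`) being supplied by BHK 2006 Thm. 1.5
CONDITIONED ON `{C_{a₁} ∩ (X ∪ {a₂}) = ∅}` (`rbhk_twoCluster_avoid`, file `…AL5RestrictedBHK.lean`).
[cite: KozmaNitzan2024, Lemma 3 (pp. 6–7)] [cite: VandenbergHaggstromKahn2005, Thms. 1.3–1.5 (pp. 6–8)]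
-/

namespace Summit.CriticalPhenomena.PercolationContinuityZ3.Theorems

open MeasureTheory Set
open Literature.Probability.LatticeModels (prodBernoulli)
open Literature.Probability.Percolation
open Literature.Probability.Percolation.BHK2006
open DecisionTree (ind ind_of_mem ind_of_not_mem ind_nonneg)

noncomputable section
open Classical

section RestrictedLemma3

variable {V : Type*} [Fintype V]

/-- **Positive correlation of two `C_s`-increasing events given `{C_t ∩ X = ∅}`** (`s ∈ X`, `t ∉ X`):
`μ(N ∩ A) μ(N ∩ Q) ≤ μ(N) μ(N ∩ (A ∩ Q))`, `N = {t ↮ X}`, for `A, Q` increasing and determined by `C_s`.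
[cite: VandenbergHaggstromKahn2005, Thm. 1.5 (pp. 7–8), Thm. 1.3 (p. 6)] -/
theorem rbhk_pos (w : Sym2 V → unitInterval) (t s : V) (X : Set V) (hsX : s ∈ X) (htX : t ∉ X)
    (A Q : Set (BondConfig V))
    (hA : ∀ ω ω', ω ∈ A → openEdgeCluster ω s ⊆ openEdgeCluster ω' s → ω' ∈ A)
    (hQ : ∀ ω ω', ω ∈ Q → openEdgeCluster ω s ⊆ openEdgeCluster ω' s → ω' ∈ Q) :
    (prodBernoulli w).real ({ω : BondConfig V | ∀ x ∈ X, ¬ (openGraph ω).Reachable t x} ∩ A) *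
        (prodBernoulli w).real ({ω : BondConfig V | ∀ x ∈ X, ¬ (openGraph ω).Reachable t x} ∩ Q) ≤
      (prodBernoulli w).real {ω : BondConfig V | ∀ x ∈ X, ¬ (openGraph ω).Reachable t x} *
        (prodBernoulli w).real ({ω : BondConfig V | ∀ x ∈ X, ¬ (openGraph ω).Reachable t x} ∩ (A ∩ Q)) := by
  have key := rbhk_twoCluster_avoid w t s X hsX htX
    (fun C _ => {C : Set (Sym2 V) | ∃ ω ∈ A, openEdgeCluster ω s ⊆ C}.indicator (1 : Set (Sym2 V) → ℝ) C)
    (fun C _ => {C : Set (Sym2 V) | ∃ ω ∈ Q, openEdgeCluster ω s ⊆ C}.indicator (1 : Set (Sym2 V) → ℝ) C)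
    (fun _ => knLemma3i_monotone_indicator_upClosure A s) (fun _ => antitone_const)
    (fun _ => knLemma3i_monotone_indicator_upClosure Q s) (fun _ => antitone_const)
  have hmA : MeasurableSet A := MeasurableSet.of_discrete
  have hmQ : MeasurableSet Q := MeasurableSet.of_discrete
  simp only [knLemma3i_indicator_upClosure_openEdgeCluster hA,
    knLemma3i_indicator_upClosure_openEdgeCluster hQ] at key
  rw [show (fun ω : BondConfig V => A.indicator (1 : BondConfig V → ℝ) ω * Q.indicator 1 ω) =
      (A ∩ Q).indicator 1 from funext fun ω =>
        (congrFun (Set.inter_indicator_one (s := A) (t := Q) (M₀ := ℝ)) ω).symm] at key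
  rw [setIntegral_indicator (hmA.inter hmQ), setIntegral_indicator hmA, setIntegral_indicator hmQ] at key
  simpa only [Pi.one_apply, setIntegral_const, smul_eq_mul, mul_one] using key

/-- The indicator of the complement of the up-closure of `B` is a decreasing function of the set of edges, and at
`C_t ω` it equals `1_{Bᶜ}(ω)` when `B` is increasing and determined by `C_t`. [folklore] -/
theorem rbhk_indicator_compl_upClosure (B : Set (BondConfig V)) (t : V)
    (hB : ∀ ω ω', ω ∈ B → openEdgeCluster ω t ⊆ openEdgeCluster ω' t → ω' ∈ B) :
    Antitone ({C : Set (Sym2 V) | ∃ ω ∈ B, openEdgeCluster ω t ⊆ C}ᶜ.indicator (1 : Set (Sym2 V) → ℝ)) ∧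
      ∀ ω : BondConfig V, {C : Set (Sym2 V) | ∃ ω ∈ B, openEdgeCluster ω t ⊆ C}ᶜ.indicator
        (1 : Set (Sym2 V) → ℝ) (openEdgeCluster ω t) = Bᶜ.indicator 1 ω := by
  constructor
  · intro C C' hCC'
    by_cases h : C' ∈ {C : Set (Sym2 V) | ∃ ω ∈ B, openEdgeCluster ω t ⊆ C}ᶜ
    · have h' : C ∈ {C : Set (Sym2 V) | ∃ ω ∈ B, openEdgeCluster ω t ⊆ C}ᶜ := by
        intro hC
        obtain ⟨ω, hω, hsub⟩ := hC
        exact h ⟨ω, hω, hsub.trans hCC'⟩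
      simp only [indicator_of_mem h, indicator_of_mem h', Pi.one_apply, le_refl]
    · rw [indicator_of_notMem h]
      exact indicator_nonneg (fun _ _ => zero_le_one) _
  · intro ω
    by_cases hω : ω ∈ B
    · have h1 : openEdgeCluster ω t ∉ {C : Set (Sym2 V) | ∃ ω' ∈ B, openEdgeCluster ω' t ⊆ C}ᶜ :=
        fun h => h ⟨ω, hω, subset_rfl⟩
      rw [indicator_of_notMem h1, indicator_of_notMem (Set.notMem_compl_iff.mpr hω)]
    · have h1 : openEdgeCluster ω t ∈ {C : Set (Sym2 V) | ∃ ω' ∈ B, openEdgeCluster ω' t ⊆ C}ᶜ := by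
        rintro ⟨ω', hω', hsub⟩
        exact hω (hB ω' ω hω' hsub)
      rw [indicator_of_mem h1, indicator_of_mem (show ω ∈ Bᶜ from hω), Pi.one_apply, Pi.one_apply]

/-- **Negative correlation, given `{C_t ∩ X = ∅}`, of a `C_t`-increasing event `B` and a `C_s`-increasing event `Q`**
(`s ∈ X`, `t ∉ X`): `μ(N) μ(N ∩ (B ∩ Q)) ≤ μ(N ∩ B) μ(N ∩ Q)`, `N = {t ↮ X}`.
[cite: VandenbergHaggstromKahn2005, Thm. 1.5 (pp. 7–8), Thm. 1.4 (p. 7)] -/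
theorem rbhk_neg (w : Sym2 V → unitInterval) (t s : V) (X : Set V) (hsX : s ∈ X) (htX : t ∉ X)
    (B Q : Set (BondConfig V))
    (hB : ∀ ω ω', ω ∈ B → openEdgeCluster ω t ⊆ openEdgeCluster ω' t → ω' ∈ B)
    (hQ : ∀ ω ω', ω ∈ Q → openEdgeCluster ω s ⊆ openEdgeCluster ω' s → ω' ∈ Q) :
    (prodBernoulli w).real {ω : BondConfig V | ∀ x ∈ X, ¬ (openGraph ω).Reachable t x} *
        (prodBernoulli w).real ({ω : BondConfig V | ∀ x ∈ X, ¬ (openGraph ω).Reachable t x} ∩ (B ∩ Q)) ≤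
      (prodBernoulli w).real ({ω : BondConfig V | ∀ x ∈ X, ¬ (openGraph ω).Reachable t x} ∩ B) *
        (prodBernoulli w).real ({ω : BondConfig V | ∀ x ∈ X, ¬ (openGraph ω).Reachable t x} ∩ Q) := by
  set N : Set (BondConfig V) := {ω | ∀ x ∈ X, ¬ (openGraph ω).Reachable t x} with hN
  obtain ⟨hanti, heval⟩ := rbhk_indicator_compl_upClosure B t hB
  have key := rbhk_twoCluster_avoid w t s X hsX htX
    (fun C _ => {C : Set (Sym2 V) | ∃ ω ∈ Q, openEdgeCluster ω s ⊆ C}.indicator (1 : Set (Sym2 V) → ℝ) C)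
    (fun _ D => {C : Set (Sym2 V) | ∃ ω ∈ B, openEdgeCluster ω t ⊆ C}ᶜ.indicator (1 : Set (Sym2 V) → ℝ) D)
    (fun _ => knLemma3i_monotone_indicator_upClosure Q s) (fun _ => antitone_const)
    (fun _ => monotone_const) (fun _ => hanti)
  have hmB : MeasurableSet (Bᶜ : Set (BondConfig V)) := MeasurableSet.of_discrete
  have hmQ : MeasurableSet Q := MeasurableSet.of_discrete
  simp only [knLemma3i_indicator_upClosure_openEdgeCluster hQ, heval] at key
  rw [show (fun ω : BondConfig V => Q.indicator (1 : BondConfig V → ℝ) ω * Bᶜ.indicator 1 ω) =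
      (Q ∩ Bᶜ).indicator 1 from funext fun ω =>
        (congrFun (Set.inter_indicator_one (s := Q) (t := Bᶜ) (M₀ := ℝ)) ω).symm] at key
  rw [setIntegral_indicator (hmQ.inter hmB), setIntegral_indicator hmQ, setIntegral_indicator hmB] at key
  simp only [Pi.one_apply, setIntegral_const, smul_eq_mul, mul_one] at key
  change (prodBernoulli w).real (N ∩ Q) * (prodBernoulli w).real (N ∩ Bᶜ) ≤
    (prodBernoulli w).real N * (prodBernoulli w).real (N ∩ (Q ∩ Bᶜ)) at key
  -- complements: `μ(N ∩ Bᶜ) = μ(N) - μ(N ∩ B)`, `μ(N ∩ (Q ∩ Bᶜ)) = μ(N ∩ Q) - μ(N ∩ (B ∩ Q))`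
  have hBm : MeasurableSet (B : Set (BondConfig V)) := MeasurableSet.of_discrete
  have h1 := measureReal_inter_add_sdiff (μ := prodBernoulli w) (s := N) hBm
  have h2 := measureReal_inter_add_sdiff (μ := prodBernoulli w) (s := N ∩ Q) hBm
  have hd1 : N \ B = N ∩ Bᶜ := Set.ext fun _ => Iff.rfl
  have hd2 : (N ∩ Q) \ B = N ∩ Q ∩ Bᶜ := Set.ext fun _ => Iff.rfl
  rw [hd1] at h1
  rw [hd2] at h2
  have e2 : N ∩ (Q ∩ Bᶜ) = N ∩ Q ∩ Bᶜ := (Set.inter_assoc _ _ _).symm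
  have e3 : N ∩ (B ∩ Q) = N ∩ Q ∩ B := by
    rw [Set.inter_comm B Q, Set.inter_assoc]
  rw [e2] at key
  rw [e3]
  nlinarith [key, h1, h2, measureReal_nonneg (μ := prodBernoulli w) (s := N ∩ Q),
    measureReal_nonneg (μ := prodBernoulli w) (s := N)]

/-- **Kozma–Nitzan Lemma 3(i) restricted to `{C_{a₁} ∩ X = ∅}`, core form** (`a₂ ∈ X`, `a₁ ∉ X`): with
`M = {a₁ ↮ X}`, `Q` increasing and determined by `C_{a₂}`, `d ≥ 0`:
`μ(M ∩ {a₁↔b}) ≤ μ(M ∩ {a₂↔b}) + d ⟹ μ(M ∩ {a₁↔b} ∩ Q) ≤ μ(M ∩ {a₂↔b} ∩ Q) + d`.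
[cite: KozmaNitzan2024, Lemma 3(i) (pp. 6–7)] [cite: VandenbergHaggstromKahn2005, Thms. 1.3–1.5] -/
theorem knLemma3i_restricted_core (w : Sym2 V → unitInterval) (a₁ a₂ b : V) (X : Set V) (ha₂X : a₂ ∈ X)
    (ha₁X : a₁ ∉ X) (Q : Set (BondConfig V)) (d : ℝ)
    (hQ : ∀ ω ω', ω ∈ Q → openEdgeCluster ω a₂ ⊆ openEdgeCluster ω' a₂ → ω' ∈ Q) (hd : 0 ≤ d)
    (hle : (prodBernoulli w).real ({ω : BondConfig V | ∀ x ∈ X, ¬ (openGraph ω).Reachable a₁ x} ∩ openConn a₁ b) ≤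
      (prodBernoulli w).real ({ω : BondConfig V | ∀ x ∈ X, ¬ (openGraph ω).Reachable a₁ x} ∩ openConn a₂ b) + d) :
    (prodBernoulli w).real ({ω : BondConfig V | ∀ x ∈ X, ¬ (openGraph ω).Reachable a₁ x} ∩ openConn a₁ b ∩ Q) ≤
      (prodBernoulli w).real ({ω : BondConfig V | ∀ x ∈ X, ¬ (openGraph ω).Reachable a₁ x} ∩ openConn a₂ b ∩ Q)
        + d := by
  set N : Set (BondConfig V) := {ω | ∀ x ∈ X, ¬ (openGraph ω).Reachable a₁ x} with hN
  have hB : ∀ ω ω', ω ∈ (openConn a₁ b : Set (BondConfig V)) →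
      openEdgeCluster ω a₁ ⊆ openEdgeCluster ω' a₁ → ω' ∈ (openConn a₁ b : Set (BondConfig V)) := by
    intro ω ω' hω hsub
    rw [openConn, Set.mem_setOf_eq, reachable_iff_exists_mem_openEdgeCluster] at hω ⊢
    exact hω.imp id fun ⟨e, he, hbe⟩ => ⟨e, hsub he, hbe⟩
  have hA : ∀ ω ω', ω ∈ (openConn a₂ b : Set (BondConfig V)) →
      openEdgeCluster ω a₂ ⊆ openEdgeCluster ω' a₂ → ω' ∈ (openConn a₂ b : Set (BondConfig V)) := by
    intro ω ω' hω hsub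
    rw [openConn, Set.mem_setOf_eq, reachable_iff_exists_mem_openEdgeCluster] at hω ⊢
    exact hω.imp id fun ⟨e, he, hbe⟩ => ⟨e, hsub he, hbe⟩
  have hI := rbhk_neg w a₁ a₂ X ha₂X ha₁X (openConn a₁ b) Q hB hQ
  have hII := rbhk_pos w a₁ a₂ X ha₂X ha₁X (openConn a₂ b) Q hA hQ
  change (prodBernoulli w).real N * (prodBernoulli w).real (N ∩ (openConn a₁ b ∩ Q)) ≤
    (prodBernoulli w).real (N ∩ openConn a₁ b) * (prodBernoulli w).real (N ∩ Q) at hI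
  change (prodBernoulli w).real (N ∩ openConn a₂ b) * (prodBernoulli w).real (N ∩ Q) ≤
    (prodBernoulli w).real N * (prodBernoulli w).real (N ∩ (openConn a₂ b ∩ Q)) at hII
  rw [Set.inter_assoc, Set.inter_assoc]
  refine knLemma3Mixed_arith hd measureReal_nonneg
    (measureReal_mono Set.inter_subset_left (measure_ne_top _ _)) measureReal_nonneg
    (measureReal_mono Set.inter_subset_left (measure_ne_top _ _)) hI hII hle

/-- **Kozma–Nitzan Lemma 3(i) restricted to `{C_{a₁} ∩ X = ∅}`** (general `X ∌ a₁`, `a₁ ≠ a₂`): with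
`M = {a₁ ↮ X}`, `Q` increasing and determined by `C_{a₂}`, `d ≥ 0`,
`μ(M ∩ {a₁↔b}) ≤ μ(M ∩ {a₂↔b}) + d ⟹ μ(M ∩ {a₁↔b} ∩ Q) ≤ μ(M ∩ {a₂↔b} ∩ Q) + d`.
(Reduction to the core form with `X ∪ {a₂}`: on `{a₁ ↔ a₂}` the events `{a₁ ↔ b}`, `{a₂ ↔ b}` coincide.)
For `X = ∅` this is `knLemma3i`. [cite: KozmaNitzan2024, Lemma 3(i) (pp. 6–7)] -/
theorem knLemma3i_restricted (w : Sym2 V → unitInterval) (a₁ a₂ b : V) (X : Set V) (ha₁X : a₁ ∉ X)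
    (h12 : a₁ ≠ a₂) (Q : Set (BondConfig V)) (d : ℝ)
    (hQ : ∀ ω ω', ω ∈ Q → openEdgeCluster ω a₂ ⊆ openEdgeCluster ω' a₂ → ω' ∈ Q) (hd : 0 ≤ d)
    (hle : (prodBernoulli w).real ({ω : BondConfig V | ∀ x ∈ X, ¬ (openGraph ω).Reachable a₁ x} ∩ openConn a₁ b) ≤
      (prodBernoulli w).real ({ω : BondConfig V | ∀ x ∈ X, ¬ (openGraph ω).Reachable a₁ x} ∩ openConn a₂ b) + d) :
    (prodBernoulli w).real ({ω : BondConfig V | ∀ x ∈ X, ¬ (openGraph ω).Reachable a₁ x} ∩ openConn a₁ b ∩ Q) ≤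
      (prodBernoulli w).real ({ω : BondConfig V | ∀ x ∈ X, ¬ (openGraph ω).Reachable a₁ x} ∩ openConn a₂ b ∩ Q)
        + d := by
  set M : Set (BondConfig V) := {ω | ∀ x ∈ X, ¬ (openGraph ω).Reachable a₁ x} with hM
  set M' : Set (BondConfig V) := {ω | ∀ x ∈ insert a₂ X, ¬ (openGraph ω).Reachable a₁ x} with hM'
  have hM'eq : M' = M \ (openConn a₁ a₂ : Set (BondConfig V)) := by
    ext ω
    simp only [hM', hM, Set.mem_setOf_eq, Set.mem_insert_iff, forall_eq_or_imp, Set.mem_sdiff, openConn]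
    tauto
  have hDm : MeasurableSet (openConn a₁ a₂ : Set (BondConfig V)) := MeasurableSet.of_discrete
  -- on `{a₁ ↔ a₂}` the two events agree
  have hagree : ∀ E : Set (BondConfig V),
      M ∩ openConn a₁ b ∩ E ∩ openConn a₁ a₂ = M ∩ openConn a₂ b ∩ E ∩ openConn a₁ a₂ := by
    intro E
    ext ω
    simp only [Set.mem_inter_iff, openConn, Set.mem_setOf_eq]
    constructor
    · rintro ⟨⟨⟨hM1, h1⟩, hE⟩, h2⟩
      exact ⟨⟨⟨hM1, h2.symm.trans h1⟩, hE⟩, h2⟩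
    · rintro ⟨⟨⟨hM1, h1⟩, hE⟩, h2⟩
      exact ⟨⟨⟨hM1, h2.trans h1⟩, hE⟩, h2⟩
  have hsplit : ∀ (c : V) (E : Set (BondConfig V)),
      (prodBernoulli w).real (M ∩ openConn c b ∩ E) =
        (prodBernoulli w).real (M ∩ openConn c b ∩ E ∩ openConn a₁ a₂) +
          (prodBernoulli w).real (M' ∩ openConn c b ∩ E) := by
    intro c E
    have h := measureReal_inter_add_sdiff (μ := prodBernoulli w) (s := M ∩ openConn c b ∩ E) hDm
    rw [← h]
    congr 1
    rw [hM'eq]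
    congr 1
    ext ω
    simp only [Set.mem_sdiff, Set.mem_inter_iff]
    tauto
  have hcore := knLemma3i_restricted_core w a₁ a₂ b (insert a₂ X) (Set.mem_insert _ _)
    (by simp only [Set.mem_insert_iff, not_or]; exact ⟨h12, ha₁X⟩) Q d hQ hd
  change (prodBernoulli w).real (M' ∩ openConn a₁ b) ≤ (prodBernoulli w).real (M' ∩ openConn a₂ b) + d →
    (prodBernoulli w).real (M' ∩ openConn a₁ b ∩ Q) ≤ (prodBernoulli w).real (M' ∩ openConn a₂ b ∩ Q) + d
    at hcore
  have hu1 := hsplit a₁ Set.univ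
  have hu2 := hsplit a₂ Set.univ
  have hq1 := hsplit a₁ Q
  have hq2 := hsplit a₂ Q
  have hag1 := hagree Set.univ
  simp only [Set.inter_univ] at hu1 hu2 hag1
  rw [hag1] at hu1
  rw [hagree Q] at hq1
  have hle' : (prodBernoulli w).real (M' ∩ openConn a₁ b) ≤ (prodBernoulli w).real (M' ∩ openConn a₂ b) + d := by
    linarith
  have := hcore hle'
  linarith

end RestrictedLemma3

end

end Summit.CriticalPhenomena.PercolationContinuityZ3.Theorems
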